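import Summits.CriticalPhenomena.PercolationContinuityZ3.Theorems.Transplant.Slab111HubBuild
import HarnessLib

/-!
# The HUB ROUTING of the `(111)`-films, VII: dispatcher ENTRIES — decidable well-formedness and the swap pair from an entry placed in a gap

builds on p205010 (kernel theorem, internal audit signed; external expert review pending) — NOT used in this file.  Lane `prim-bschramm`, seat
`prim-bschramm-p2` (gen 36; class C1b; memo `HOME/bschramm/P2-LATTICES.md` §130); helper file (`--supports stmt-CriticalPhenomena-4575 --as helper`).
A dispatcher TABLE ENTRY is pure data: three faces with attachment directions and three relative legs (`Entry`).  Its well-formedness relative to a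
column triple, the leg DIRECTIONS (each leg climbs towards the hub zone) and the EXCLUSION pattern (which terminals lie between another terminal and
the zone) is the decidable predicate **`Entry.ok`** — what the per-shape tables certify by `decide`.  **`Entry.swap`**: a well-formed entry, a
configuration whose levels put the zone in the required gap (margins `Λ + 2`), pairwise level-far terminals (`> 2Λ`), and the "not between ⇒ far side"
arithmetic give a `HubPlan` («Slab111HubPlan») and hence a swap pair («Slab111HubBuild»).  `Λ` bounds the leg lengths.
[cite: DuminilCopinSidoraviciusTassion2016, §2.3 (proof of Fact 2: the three disjoint paths γ_u, γ_v, γ_w in B_R(z))]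
-/

noncomputable section

namespace Summit.CriticalPhenomena.PercolationContinuityZ3.Theorems.Transplant

open Literature.Probability.Percolation Literature.Probability.LatticeModels SimpleGraph
open scoped Classical

namespace Slab111

variable {k : ℕ}

/-- **A dispatcher entry**: faces, attachment directions, relative legs. [folklore] -/
structure Entry where
  /-- faces of `E₁, E₂, w'` -/
  (F1 F2 F3 : FaceD)
  /-- attachment directions -/
  (d₁ d₂ d₃ : ℤ)
  /-- relative legs (model chains from the terminal `((0,0),0)` to a vertex of the face) -/
  (l₁ l₂ l₃ : List MV)
deriving Repr

/-- Decidable form of `LegOK`. [folklore] -/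
instance (l : List MV) : Decidable (LegOK l) := by unfold LegOK; infer_instance

/-- **Well-formedness of one leg** of an entry for the terminal column `q`, the face `F`, the region columns `C`, the climbing direction `dir`
(`±1`) and the leg bound `Λ`: well-formed chain; ends on `F`; other vertices off `F` and (except the terminal) over `C`, at relative levels
`1 ≤ dir·Δℓ ≤ Λ`; the end at relative level `0 ≤ dir·Δℓ ≤ Λ`. [folklore] -/
def LegFits (l : List MV) (q : ℤ × ℤ) (F : FaceD) (C : List (ℤ × ℤ)) (dir Λ : ℤ) : Prop :=
  ∃ h : LegOK l, F.mem (q + (l.getLast h.1).1) ∧ 0 ≤ dir * (l.getLast h.1).2 ∧ dir * (l.getLast h.1).2 ≤ Λ ∧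
    (∀ p ∈ l, p ≠ l.getLast h.1 → ¬ F.mem (q + p.1)) ∧
    (∀ p ∈ l, p ≠ ((0, 0), 0) → q + p.1 ∈ C ∧ 1 ≤ dir * p.2 ∧ dir * p.2 ≤ Λ)

/-- `LegFits` is decidable. [folklore] -/
instance (l : List MV) (q : ℤ × ℤ) (F : FaceD) (C : List (ℤ × ℤ)) (dir Λ : ℤ) : Decidable (LegFits l q F C dir Λ) := by
  unfold LegFits; infer_instance

/-- The columns of the non-last vertices of a leg avoid the face `G`. [folklore] -/
def LegAvoids (l : List MV) (q : ℤ × ℤ) (G : FaceD) : Prop := ∀ p ∈ l, (∃ h : l ≠ [], p ≠ l.getLast h) → ¬ G.mem (q + p.1)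

/-- `LegAvoids` is decidable. [folklore] -/
instance (l : List MV) (q : ℤ × ℤ) (G : FaceD) : Decidable (LegAvoids l q G) := by unfold LegAvoids; infer_instance

/-- **Well-formedness of an entry** for the column triple `q`, region column lists `Pc ⊇` rerouting columns and `Wc`, climbing directions
`dir₁ dir₂ dir₃ = ±1`, leg bound `Λ`, and exclusion bits `xIJ` (when set, the leg of terminal `J` must avoid the columns of face `I`). [folklore] -/
def Entry.ok (e : Entry) (Pc Wc : List (ℤ × ℤ)) (q₁ q₂ q₃ : ℤ × ℤ) (dir₁ dir₂ dir₃ Λ : ℤ) (x21 x31 x12 x32 x13 x23 : Bool) : Prop :=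
  e.F1.ok ∧ e.F2.ok ∧ e.F3.ok ∧ e.F1.OffHub ∧ e.F2.OffHub ∧ e.F3.OffHub ∧ e.F1.Disj e.F2 ∧ e.F1.Disj e.F3 ∧ e.F2.Disj e.F3 ∧
  Att e.F1 e.d₁ ∧ Att e.F2 e.d₂ ∧ Att e.F3 e.d₃ ∧
  (e.F1.f0 ∈ Pc ∧ e.F1.f1 ∈ Pc ∧ e.F1.f2 ∈ Pc) ∧ (e.F2.f0 ∈ Pc ∧ e.F2.f1 ∈ Pc ∧ e.F2.f2 ∈ Pc) ∧ (e.F3.f0 ∈ Wc ∧ e.F3.f1 ∈ Wc ∧ e.F3.f2 ∈ Wc) ∧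
  ((0 : ℤ), (0 : ℤ)) ∈ Pc ∧
  LegFits e.l₁ q₁ e.F1 Pc dir₁ Λ ∧ LegFits e.l₂ q₂ e.F2 Pc dir₂ Λ ∧ LegFits e.l₃ q₃ e.F3 Wc dir₃ Λ ∧
  (x21 = true → LegAvoids e.l₁ q₁ e.F2) ∧ (x31 = true → LegAvoids e.l₁ q₁ e.F3) ∧ (x12 = true → LegAvoids e.l₂ q₂ e.F1) ∧
  (x32 = true → LegAvoids e.l₂ q₂ e.F3) ∧ (x13 = true → LegAvoids e.l₃ q₃ e.F1) ∧ (x23 = true → LegAvoids e.l₃ q₃ e.F2)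

/-- `Entry.ok` is decidable. [folklore] -/
instance (e : Entry) (Pc Wc : List (ℤ × ℤ)) (q₁ q₂ q₃ : ℤ × ℤ) (dir₁ dir₂ dir₃ Λ : ℤ) (x21 x31 x12 x32 x13 x23 : Bool) :
    Decidable (e.ok Pc Wc q₁ q₂ q₃ dir₁ dir₂ dir₃ Λ x21 x31 x12 x32 x13 x23) := by unfold Entry.ok; infer_instance

/-- Levels of the vertices of a fitting leg: the non-last ones are within `[n − Λ, n + Λ]` and, except the terminal, strictly on the `dir` side. [folklore] -/
theorem LegFits.lev_bounds {l : List MV} {q : ℤ × ℤ} {F : FaceD} {C : List (ℤ × ℤ)} {dir Λ : ℤ} (hdir : dir = 1 ∨ dir = -1) (h : LegFits l q F C dir Λ)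
    {p : MV} (hp : p ∈ l) : -Λ ≤ p.2 ∧ p.2 ≤ Λ ∧ 0 ≤ dir * p.2 := by
  obtain ⟨hl, -, h0, hΛ, -, hrest⟩ := h
  by_cases hp0 : p = ((0, 0), 0)
  · subst hp0; rcases hdir with rfl | rfl <;> simp <;> omega
  · by_cases hpl : p = l.getLast hl.1
    · rw [hpl]; rcases hdir with rfl | rfl <;> constructor <;> omega
    · have := (hrest p hp hp0).2; rcases hdir with rfl | rfl <;> constructor <;> omega


/-- Arithmetic of the lower separation. [folklore] -/
theorem sep_lo {nI nJ Λ A p q : ℤ} (h : nJ + Λ < min (nI - Λ) (A - 1)) (hp : p ≤ Λ) (hq : -Λ ≤ q) : nJ + p < min (nI + q) (A - 1) := by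
  rw [lt_min_iff] at h ⊢; constructor <;> omega

/-- Arithmetic of the upper separation. [folklore] -/
theorem sep_hi {nI nJ Λ B p q : ℤ} (h : max (nI + Λ) (B + 1) < nJ - Λ) (hp : -Λ ≤ p) (hq : q ≤ Λ) : max (nI + q) (B + 1) < nJ + p := by
  rw [max_lt_iff] at h ⊢; constructor <;> omega


/-- Linear consequences of `1 ≤ dir·x ≤ Λ` for `dir = ±1`. [folklore] -/
theorem dir_cases {dir x Λ : ℤ} (hd : dir = 1 ∨ dir = -1) (h1 : 1 ≤ dir * x) (h2 : dir * x ≤ Λ) :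
    (dir = 1 ∧ 1 ≤ x ∧ x ≤ Λ) ∨ (dir = -1 ∧ -Λ ≤ x ∧ x ≤ -1) := by
  rcases hd with rfl | rfl
  · left; refine ⟨rfl, ?_, ?_⟩ <;> omega
  · right; refine ⟨rfl, ?_, ?_⟩ <;> omega

/-- Linear consequences of `0 ≤ dir·x ≤ Λ` for `dir = ±1`. [folklore] -/
theorem dir_cases₀ {dir x Λ : ℤ} (hd : dir = 1 ∨ dir = -1) (h1 : 0 ≤ dir * x) (h2 : dir * x ≤ Λ) :
    (dir = 1 ∧ 0 ≤ x ∧ x ≤ Λ) ∨ (dir = -1 ∧ -Λ ≤ x ∧ x ≤ 0) := by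
  rcases hd with rfl | rfl
  · left; refine ⟨rfl, ?_, ?_⟩ <;> omega
  · right; refine ⟨rfl, ?_, ?_⟩ <;> omega

/-- `0 ≤ τ·y` from the sign of `y` matching `τ = ±1`. [folklore] -/
theorem nonneg_mul_of {τ y : ℤ} (h : (τ = 1 ∧ 0 ≤ y) ∨ (τ = -1 ∧ y ≤ 0)) : 0 ≤ τ * y := by
  rcases h with ⟨rfl, hy⟩ | ⟨rfl, hy⟩ <;> omega


/-- The side condition of `E₁`: `e₁` is before `c` in the direction `dir`. [folklore] -/
theorem side_aux {dir d LA LD n x Λ : ℤ} (hA : d = 1 ∨ d = -1)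
    (hx : (dir = 1 ∧ 0 ≤ x ∧ x ≤ Λ) ∨ (dir = -1 ∧ -Λ ≤ x ∧ x ≤ 0))
    (hz : (dir = 1 → n + Λ + 2 ≤ min LA LD) ∧ (dir = -1 → max LA LD + Λ + 2 ≤ n)) : 0 ≤ dir * (LA + d - (n + x)) := by
  apply nonneg_mul_of
  rcases hx with ⟨e1, h1, h2⟩ | ⟨e1, h1, h2⟩
  · left; refine ⟨e1, ?_⟩
    have := hz.1 e1; rcases hA with e2 | e2 <;> omega
  · right; refine ⟨e1, ?_⟩
    have := hz.2 e1; rcases hA with e2 | e2 <;> omega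

/-- A leg vertex is not at a hub level. [folklore] -/
theorem hub_aux {dir LA LD n x Λ : ℤ} (hd : dir = 1 ∨ dir = -1) (hx : -Λ ≤ x ∧ x ≤ Λ ∧ 0 ≤ dir * x)
    (hz : (dir = 1 → n + Λ + 2 ≤ min LA LD) ∧ (dir = -1 → max LA LD + Λ + 2 ≤ n)) : n + x ≠ LA ∧ n + x ≠ LD := by
  rcases hd with e | e
  · have := hz.1 e; subst e; constructor <;> omega
  · have := hz.2 e; subst e; constructor <;> omega

/-- A non-terminal leg vertex is at a level in `[1, k−1]`. [folklore] -/
theorem lev_aux {dir LA LD n x Λ K : ℤ} (hx : (dir = 1 ∧ 1 ≤ x ∧ x ≤ Λ) ∨ (dir = -1 ∧ -Λ ≤ x ∧ x ≤ -1)) (hn : 0 ≤ n ∧ n ≤ K)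
    (hz : (dir = 1 → n + Λ + 2 ≤ min LA LD) ∧ (dir = -1 → max LA LD + Λ + 2 ≤ n)) (hLA : 2 ≤ LA ∧ LA ≤ K - 2) (hLD : 2 ≤ LD ∧ LD ≤ K - 2) :
    1 ≤ n + x ∧ n + x ≤ K - 1 := by
  rcases hx with ⟨e, h1, h2⟩ | ⟨e, h1, h2⟩
  · have := hz.1 e; constructor <;> omega
  · have := hz.2 e; constructor <;> omega

/-- Level-far legs have distinct vertices. [folklore] -/
theorem far_aux {n₁ n₂ x y Λ : ℤ} (hfar : n₁ + 2 * Λ < n₂ ∨ n₂ + 2 * Λ < n₁) (hx : -Λ ≤ x ∧ x ≤ Λ) (hy : -Λ ≤ y ∧ y ≤ Λ) : n₁ + x ≠ n₂ + y := by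
  omega

set_option maxHeartbeats 1600000 in
/-- **THE SWAP PAIR FROM AN ENTRY PLACED IN A GAP.**  Given: the shape facts (bulk membership of region columns, `PR ⊆ W`); terminals over columns
`q₁, q₂, q₃` (relative to the hub) at levels `n₁, n₂, n₃`, `E₁, E₂ ∈ PR`, `w' ∈ W`, `E₁ ≠ E₂`; a well-formed entry for directions `dirᵢ` and
exclusion bits; a hub level `LA ≡ c0` with `LD = LA + 3·dir₁` (the zone `[min − 1, max + 1]` of the two hubs), both in `[2, k−2]`; every
terminal at distance `≥ Λ + 2` from the zone on the side opposite to its direction; pairwise level distance `> 2Λ` (or an explicit check that the two legs share no vertex); and for every ordered pair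
`(I, J)` either the exclusion bit `xIJ` or "`T_J` is beyond `T_I` or beyond the zone" in levels.  Then a swap pair exists.
[cite: DuminilCopinSidoraviciusTassion2016, §2.3 (proof of Fact 2: the three disjoint paths γ_u, γ_v, γ_w in B_R(z))] -/
theorem Entry.swap {h : Site 2} {c0 : ℤ} {W PR : Set (slab111 k)} {E₁ E₂ w' : slab111 k} (e : Entry)
    (hz : (3 : ℤ) ∣ h 0 + 2 * h 1 - c0) (hPRW : PR ⊆ W) {Pc Wc : List (ℤ × ℤ)}
    (hPc : ∀ q ∈ Pc, ∀ L : ℤ, 1 ≤ L → L ≤ (k : ℤ) - 1 → (3 : ℤ) ∣ L - c0 - (q.1 + 2 * q.2) → vl k (vcol h q) L ∈ PR)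
    (hWc : ∀ q ∈ Wc, ∀ L : ℤ, 1 ≤ L → L ≤ (k : ℤ) - 1 → (3 : ℤ) ∣ L - c0 - (q.1 + 2 * q.2) → vl k (vcol h q) L ∈ W)
    {q₁ q₂ q₃ : ℤ × ℤ} {n₁ n₂ n₃ : ℤ}
    (hE1 : sh E₁ = vcol h q₁ ∧ lev (E₁ : Site 3) = n₁) (hE2 : sh E₂ = vcol h q₂ ∧ lev (E₂ : Site 3) = n₂)
    (hE3 : sh w' = vcol h q₃ ∧ lev (w' : Site 3) = n₃) (hE1P : E₁ ∈ PR) (hE2P : E₂ ∈ PR) (hE3W : w' ∈ W) (hne : E₁ ≠ E₂)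
    (hn1 : 0 ≤ n₁ ∧ n₁ ≤ k) (hn2 : 0 ≤ n₂ ∧ n₂ ≤ k) (hn3 : 0 ≤ n₃ ∧ n₃ ≤ k)
    {dir₁ dir₂ dir₃ Λ : ℤ} (hd1 : dir₁ = 1 ∨ dir₁ = -1) (hd2 : dir₂ = 1 ∨ dir₂ = -1) (hd3 : dir₃ = 1 ∨ dir₃ = -1)
    {x21 x31 x12 x32 x13 x23 : Bool} (hok : e.ok Pc Wc q₁ q₂ q₃ dir₁ dir₂ dir₃ Λ x21 x31 x12 x32 x13 x23)
    {LA LD : ℤ} (hLA : (3 : ℤ) ∣ LA - c0) (hLD : LD = LA + 3 * dir₁) (hLA2 : 2 ≤ LA) (hLAk : LA ≤ (k : ℤ) - 2) (hLD2 : 2 ≤ LD) (hLDk : LD ≤ (k : ℤ) - 2)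
    (hz1 : (dir₁ = 1 → n₁ + Λ + 2 ≤ min LA LD) ∧ (dir₁ = -1 → max LA LD + Λ + 2 ≤ n₁))
    (hz2 : (dir₂ = 1 → n₂ + Λ + 2 ≤ min LA LD) ∧ (dir₂ = -1 → max LA LD + Λ + 2 ≤ n₂))
    (hz3 : (dir₃ = 1 → n₃ + Λ + 2 ≤ min LA LD) ∧ (dir₃ = -1 → max LA LD + Λ + 2 ≤ n₃))
    (f12 : (n₁ + 2 * Λ < n₂ ∨ n₂ + 2 * Λ < n₁) ∨
      ∀ p ∈ e.l₁, ∀ p' ∈ e.l₂, -Λ ≤ p.2 → p.2 ≤ Λ → -Λ ≤ p'.2 → p'.2 ≤ Λ → (q₁ + p.1, n₁ + p.2) ≠ (q₂ + p'.1, n₂ + p'.2))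
    (f13 : (n₁ + 2 * Λ < n₃ ∨ n₃ + 2 * Λ < n₁) ∨
      ∀ p ∈ e.l₁, ∀ p' ∈ e.l₃, -Λ ≤ p.2 → p.2 ≤ Λ → -Λ ≤ p'.2 → p'.2 ≤ Λ → (q₁ + p.1, n₁ + p.2) ≠ (q₃ + p'.1, n₃ + p'.2))
    (f23 : (n₂ + 2 * Λ < n₃ ∨ n₃ + 2 * Λ < n₂) ∨
      ∀ p ∈ e.l₂, ∀ p' ∈ e.l₃, -Λ ≤ p.2 → p.2 ≤ Λ → -Λ ≤ p'.2 → p'.2 ≤ Λ → (q₂ + p.1, n₂ + p.2) ≠ (q₃ + p'.1, n₃ + p'.2))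
    (s21 : x21 = true ∨ n₁ + Λ < min (n₂ - Λ) (min LA LD - 1) ∨ max (n₂ + Λ) (max LA LD + 1) < n₁ - Λ)
    (s31 : x31 = true ∨ n₁ + Λ < min (n₃ - Λ) (min LA LD - 1) ∨ max (n₃ + Λ) (max LA LD + 1) < n₁ - Λ)
    (s12 : x12 = true ∨ n₂ + Λ < min (n₁ - Λ) (min LA LD - 1) ∨ max (n₁ + Λ) (max LA LD + 1) < n₂ - Λ)
    (s32 : x32 = true ∨ n₂ + Λ < min (n₃ - Λ) (min LA LD - 1) ∨ max (n₃ + Λ) (max LA LD + 1) < n₂ - Λ)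
    (s13 : x13 = true ∨ n₃ + Λ < min (n₁ - Λ) (min LA LD - 1) ∨ max (n₁ + Λ) (max LA LD + 1) < n₃ - Λ)
    (s23 : x23 = true ∨ n₃ + Λ < min (n₂ - Λ) (min LA LD - 1) ∨ max (n₂ + Λ) (max LA LD + 1) < n₃ - Λ) :
    ∃ r₁ r₂ : VRouteData (film k) PR W E₁ E₂ w', r₁.y = r₂.b ∧ r₁.b = r₂.y := by
  obtain ⟨hF1, hF2, hF3, ho1, ho2, ho3, h12, h13, h23, hA1, hA2, hA3, hF1P, hF2P, hF3W, hhub, hL1, hL2, hL3,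
    hx21, hx31, hx12, hx32, hx13, hx23⟩ := hok
  obtain ⟨hl1, he1, he1a, he1b, ho1', hc1⟩ := hL1
  obtain ⟨hl2, he2, he2a, he2b, ho2', hc2⟩ := hL2
  obtain ⟨hl3, he3, he3a, he3b, ho3', hc3⟩ := hL3
  -- level bounds of leg vertices
  have lb1 := fun p hp => LegFits.lev_bounds hd1 ⟨hl1, he1, he1a, he1b, ho1', hc1⟩ (p := p) hp
  have lb2 := fun p hp => LegFits.lev_bounds hd2 ⟨hl2, he2, he2a, he2b, ho2', hc2⟩ (p := p) hp
  have lb3 := fun p hp => LegFits.lev_bounds hd3 ⟨hl3, he3, he3a, he3b, ho3', hc3⟩ (p := p) hp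
  -- the last vertex's level is on the `dir` side within `Λ`
  have P : HubPlan k h c0 W PR E₁ E₂ w' :=
  { Pc := Pc, Wc := Wc, q₁ := q₁, q₂ := q₂, q₃ := q₃, n₁ := n₁, n₂ := n₂, n₃ := n₃,
    F1 := e.F1, F2 := e.F2, F3 := e.F3, d₁ := e.d₁, d₂ := e.d₂, d₃ := e.d₃, l₁ := e.l₁, l₂ := e.l₂, l₃ := e.l₃,
    LA := LA, LD := LD, τ := dir₁,
    hz := hz, hPRW := hPRW, hPc := hPc, hWc := hWc, hE1 := hE1, hE2 := hE2, hE3 := hE3, hE1P := hE1P, hE2P := hE2P, hE3W := hE3W, hne := hne,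
    hF1 := hF1, hF2 := hF2, hF3 := hF3, ho1 := ho1, ho2 := ho2, ho3 := ho3, h12 := h12, h13 := h13, h23 := h23, hA1 := hA1, hA2 := hA2, hA3 := hA3,
    hF1P := hF1P, hF2P := hF2P, hF3W := hF3W, hub_mem := hhub, hl1 := hl1, hl2 := hl2, hl3 := hl3, he1 := he1, he2 := he2, he3 := he3,
    ho1' := ho1', ho2' := ho2', ho3' := ho3',
    hc1 := fun p hp hp0 =>
      ⟨(hc1 p hp hp0).1, lev_aux (dir_cases hd1 (hc1 p hp hp0).2.1 (hc1 p hp hp0).2.2) hn1 hz1 ⟨hLA2, hLAk⟩ ⟨hLD2, hLDk⟩⟩,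
    hc2 := fun p hp hp0 =>
      ⟨(hc2 p hp hp0).1, lev_aux (dir_cases hd2 (hc2 p hp hp0).2.1 (hc2 p hp hp0).2.2) hn2 hz2 ⟨hLA2, hLAk⟩ ⟨hLD2, hLDk⟩⟩,
    hc3 := fun p hp hp0 =>
      ⟨(hc3 p hp hp0).1, lev_aux (dir_cases hd3 (hc3 p hp hp0).2.1 (hc3 p hp hp0).2.2) hn3 hz3 ⟨hLA2, hLAk⟩ ⟨hLD2, hLDk⟩⟩,
    hn1 := hn1, hn2 := hn2, hn3 := hn3,
    hτ := hd1, hLD := hLD, hLA := hLA, hLA2 := hLA2, hLAk := hLAk, hLD2 := hLD2, hLDk := hLDk,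
    hside := side_aux hA1.dir_eq (dir_cases₀ hd1 he1a he1b) hz1,
    s21 := fun p hp hpl => by
      rcases s21 with hx | hlt | hgt
      · exact Or.inl (hx21 hx p hp ⟨hl1.1, hpl⟩)
      · exact Or.inr (Or.inl (sep_lo hlt (lb1 p hp).2.1 (lb2 _ (List.getLast_mem hl2.1)).1))
      · exact Or.inr (Or.inr (sep_hi hgt (lb1 p hp).1 (lb2 _ (List.getLast_mem hl2.1)).2.1)),
    s31 := fun p hp hpl => by
      rcases s31 with hx | hlt | hgt
      · exact Or.inl (hx31 hx p hp ⟨hl1.1, hpl⟩)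
      · exact Or.inr (Or.inl (sep_lo hlt (lb1 p hp).2.1 (lb3 _ (List.getLast_mem hl3.1)).1))
      · exact Or.inr (Or.inr (sep_hi hgt (lb1 p hp).1 (lb3 _ (List.getLast_mem hl3.1)).2.1)),
    s12 := fun p hp hpl => by
      rcases s12 with hx | hlt | hgt
      · exact Or.inl (hx12 hx p hp ⟨hl2.1, hpl⟩)
      · exact Or.inr (Or.inl (sep_lo hlt (lb2 p hp).2.1 (lb1 _ (List.getLast_mem hl1.1)).1))
      · exact Or.inr (Or.inr (sep_hi hgt (lb2 p hp).1 (lb1 _ (List.getLast_mem hl1.1)).2.1)),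
    s32 := fun p hp hpl => by
      rcases s32 with hx | hlt | hgt
      · exact Or.inl (hx32 hx p hp ⟨hl2.1, hpl⟩)
      · exact Or.inr (Or.inl (sep_lo hlt (lb2 p hp).2.1 (lb3 _ (List.getLast_mem hl3.1)).1))
      · exact Or.inr (Or.inr (sep_hi hgt (lb2 p hp).1 (lb3 _ (List.getLast_mem hl3.1)).2.1)),
    s13 := fun p hp hpl => by
      rcases s13 with hx | hlt | hgt
      · exact Or.inl (hx13 hx p hp ⟨hl3.1, hpl⟩)
      · exact Or.inr (Or.inl (sep_lo hlt (lb3 p hp).2.1 (lb1 _ (List.getLast_mem hl1.1)).1))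
      · exact Or.inr (Or.inr (sep_hi hgt (lb3 p hp).1 (lb1 _ (List.getLast_mem hl1.1)).2.1)),
    s23 := fun p hp hpl => by
      rcases s23 with hx | hlt | hgt
      · exact Or.inl (hx23 hx p hp ⟨hl3.1, hpl⟩)
      · exact Or.inr (Or.inl (sep_lo hlt (lb3 p hp).2.1 (lb2 _ (List.getLast_mem hl2.1)).1))
      · exact Or.inr (Or.inr (sep_hi hgt (lb3 p hp).1 (lb2 _ (List.getLast_mem hl2.1)).2.1)),
    hh1 := fun p hp _ => Or.inr (hub_aux hd1 (lb1 p hp) hz1),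
    hh2 := fun p hp _ => Or.inr (hub_aux hd2 (lb2 p hp) hz2),
    hh3 := fun p hp _ => Or.inr (hub_aux hd3 (lb3 p hp) hz3),
    d12 := fun p hp hpl p' hp' hpl' heq => by
      have a := lb1 p hp; have b := lb2 p' hp'
      rcases f12 with hfar | hd
      · exact far_aux hfar ⟨a.1, a.2.1⟩ ⟨b.1, b.2.1⟩ (congrArg Prod.snd heq)
      · exact hd p hp p' hp' a.1 a.2.1 b.1 b.2.1 heq,
    d13 := fun p hp hpl p' hp' hpl' heq => by
      have a := lb1 p hp; have b := lb3 p' hp'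
      rcases f13 with hfar | hd
      · exact far_aux hfar ⟨a.1, a.2.1⟩ ⟨b.1, b.2.1⟩ (congrArg Prod.snd heq)
      · exact hd p hp p' hp' a.1 a.2.1 b.1 b.2.1 heq,
    d23 := fun p hp hpl p' hp' hpl' heq => by
      have a := lb2 p hp; have b := lb3 p' hp'
      rcases f23 with hfar | hd
      · exact far_aux hfar ⟨a.1, a.2.1⟩ ⟨b.1, b.2.1⟩ (congrArg Prod.snd heq)
      · exact hd p hp p' hp' a.1 a.2.1 b.1 b.2.1 heq }
  exact P.swap

end Slab111

end Summit.CriticalPhenomena.PercolationContinuityZ3.Theorems.Transplant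

end
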